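import Mathlib
import HarnessLib
import Summits.HubbardSuperconductivity.HubbardSuperconductivity.Theorems.KLProgrammeKLRegimeEngineTowerBookkeepingProfile
import Summits.HubbardSuperconductivity.HubbardSuperconductivity.Theorems.KLProgrammeKLRegimeEngineTowerLevUnitsDefs
import Summits.HubbardSuperconductivity.HubbardSuperconductivity.Theorems.KLProgrammeKLRegimeEngineTowerLevFloorUnitsDefs

/-!
# Route `KLProgramme` — crux K3 ENGINE (stmt-HubbardSuperconductivity-20437 `KLRegimeEngineV17F2`), stub (b) v2, THE LEVELS PACKAGE (ℓ):
# THE RE-BASED TOWER LAW — induction from block `1`, block `0` removed (cure (A″) of located-risk #8 «(ℓ)-BLOCK0-LOGM»;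
# cell gate-hubbard-kl, seat p4 g19; pen (R273)(E)/(R275)(C); E1 may rename or supersede)

The levelled tower law `klTowerBLev_le_law_of_inputs_scaled/_uv` (…LevLawOfInputsScaled/…UV, p4 g18) starts its block induction at `k = 0`,
where the measured array is the UV action `𝒱_0` read in the TRIVIAL family (`μ0 ∝ klTowerUVLev`).  k3c2-p3 g13 located («(ℓ)-BLOCK0-LOGM»,
KL STATUS 2026-08-28 l.9469, [calc]+[numerics]) that this datum is NOT `M`-uniform (odd-time column sums of the trivial analysis `E_t·S` are
`(2/π) ln M + O(1)`), and the pen ruled cure (A″) ((R273)(E)): DROP block `0`; START the tower at `𝒱_d`, read at the family `F_{d−1}` by ONE grid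
step (p3's `…CutoffKernelNormsWtAtFamily` at `(Λ_d, F_{d−1})`, k3c2-p3's «(ℓ)-BASE-LEV» `klTowerMuLev_le_profile_of_wtPinned`, …TowerLevBaseFromPlain),
and re-base the re-measurement of `𝒱_{dk} = 𝒱_d + Σ_{1 ≤ j < k} Δ_j` on that base (the bridge rows, k3c2-p3).  This file is the matching ASSEMBLY:

* §1 `towerBorn_le_law_tracks_of_profile_base` — the kit's track induction (`towerBorn_le_law_tracks_of_profile`, …BookkeepingProfile; unit-free,
  arrays abstract) RE-BASED: hypotheses at blocks `k ≥ 1` only (profile of the measured array at block `k` from the law on the born arrays of blocks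
  `2 ≤ k′ ≤ k` — vacuous premise at `k = 1`, i.e. a plain base profile), no `h0`, conclusion for the born arrays of blocks `2 ≤ k ≤ K`.  Proof: the kit
  applied to the shifted arrays `j ↦ k = j + 1` with a zero virtual born array at `j = 0`.
* §2 `klTowerBLev_le_law_of_inputs_base` — the instance on the half-keyed arrays of …TowerLevUnitsDefs with the scaled measured array
  `μ k m := W·Z^m·klTowerMuLev … d k m` (as in `_scaled`): NAMED inputs = the base profile at block `1` (`hbase`, `hbase3`), the re-based bridge at
  blocks `k ≥ 2` (`hR`), the imports (E1 (I4)), the step at blocks `k ≥ 1` — served VERBATIM by `klTowerBLev_succ_le_kitStep` (p664283) /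
  `klTowerBLev_succ_le_kitStep_of_bounds` (p666413 §1) — and the kit's numerics (E1 (I5), k3c3-p2's `towerLevNumerics*`).  Unlike `_scaled`, no model
  hypothesis (`R.WF2`, `FrameOK`, `KernelNormsLevels … 0`, windows) appears: nothing model-specific is discharged here, so nothing is assumed.
* §3 `klTowerBLevF_le_law_of_inputs_base` — the same instance on the FLOOR-keyed arrays `klTowerBLevF/klTowerMuLevF` of …TowerLevFloorUnitsDefs
  (cure (ε) of located-risk #10 «(ℓ)-LEV-ODD», k3c2-p3 p668906); its step input waits for the floor-keyed LINK («(I1)-LEV-FLOOR»), its base/bridge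
  inputs transfer from any half-keyed upper bound by `klTowerMuLevF_le_klTowerMuLev`.

Composition of landed theorems over abstract/named inputs; nothing about the model is asserted; nothing asserts (ℓ), any stub, K3 or superconductivity.
References: BGM 2006 §2.8 (2.83), (2.93)–(2.98) [cite: BenfattoGiulianiMastropietro2006].
-/

noncomputable section

namespace Summit.HubbardSuperconductivity.HubbardSuperconductivity.Theorems.EngineV8

set_option linter.dupNamespace false -- summit = problem name (single-conjunct summit), D-0017

open Classical
open Real Finset Literature.MathematicalPhysics.QuantumLattice Literature.Probability.LatticeModels GrassmannAlgebra
open Literature.MathematicalPhysics.QuantumLattice.FermiRG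
open Summit.HubbardSuperconductivity.HubbardSuperconductivity.Theorems.KLProgrammeLegKernels
open Summit.HubbardSuperconductivity.HubbardSuperconductivity.Theorems.KLRegimeSplit
open Summit.HubbardSuperconductivity.HubbardSuperconductivity.Theorems.DispersionFlow

/-! ## §1 The kit's track induction re-based at block `1` -/

/-- **The track induction from a base block** (re-based twin of `towerBorn_le_law_tracks_of_profile`): abstract born arrays `b t k p` and measured arrays
`μ k m`; hypotheses at blocks `1 ≤ k < K` only — the measured profile at block `k` (degrees `4 ≤ m ≤ D`, and the six-leg import `μ k 3 ≤ ι₃λ²`) from the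
law on the born arrays of the blocks `2 ≤ k′ ≤ k` (at `k = 1` the premise is empty: a plain BASE profile), the imports `μ k 1 ≤ ι₁λ`, `μ k 2 ≤ ι₂λ`, the
step `b t (k+1) p ≤ FO + Σ S + tail` read on `μ k`, and the kit's numerics; conclusion: the law `b t k p ≤ Aλ^{p−1}Q^p` at every block `2 ≤ k ≤ K`.
(The kit applied to the shifted arrays `j ↦ j + 1` with a zero virtual born array at `j = 0`.) [cite: BenfattoGiulianiMastropietro2006, §2.8 (2.93)-(2.98)] -/
theorem towerBorn_le_law_tracks_of_profile_base {T : Type*} {D K : ℕ} {b : T → ℕ → ℕ → ℝ} {μ : ℕ → ℕ → ℝ}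
    {A lam Q σ Φ ψ τ A' Q' ι₁ ι₂ ι₃ : ℝ}
    (hlam : 0 < lam) (hA : 0 ≤ A) (hQ : 0 ≤ Q)
    (hσ : 0 ≤ σ) (hΦ : 0 ≤ Φ) (hψ : 0 ≤ ψ) (hτ : 0 < τ) (hQ'0 : 0 < Q') (hA'0 : 0 ≤ A')
    (hμ0 : ∀ k, 1 ≤ k → ∀ m, 0 ≤ μ k m)
    (hprof : ∀ k, 1 ≤ k → k < K → (∀ k', 2 ≤ k' → k' ≤ k → ∀ t, ∀ p, 3 ≤ p → p ≤ D → b t k' p ≤ A * lam ^ (p - 1) * Q ^ p) →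
      ∀ m, 4 ≤ m → m ≤ D → μ k m ≤ A' * lam ^ (m - 1) * Q' ^ m)
    (hprof3 : ∀ k, 1 ≤ k → k < K → 3 ≤ D →
      (∀ k', 2 ≤ k' → k' ≤ k → ∀ t, ∀ p, 3 ≤ p → p ≤ D → b t k' p ≤ A * lam ^ (p - 1) * Q ^ p) → μ k 3 ≤ ι₃ * lam ^ 2)
    (hι₁ : ∀ k, 1 ≤ k → k < K → μ k 1 ≤ ι₁ * lam) (hι₂ : ∀ k, 1 ≤ k → k < K → μ k 2 ≤ ι₂ * lam)
    (hstep : ∀ t, ∀ k, 1 ≤ k → k < K → ∀ N : ℕ, 2 ≤ N → ∀ p, 3 ≤ p → p ≤ D → Φ * towerV D τ (μ k) < 1 →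
      b t (k + 1) p ≤ towerFO D σ (μ k) p + ∑ n ∈ Icc 2 N, exp 1 * Φ ^ (n - 1) * ψ ^ p * towerS D τ (μ k) n p +
        ψ ^ p * exp 1 * towerV D τ (μ k) * (Φ * towerV D τ (μ k)) ^ N / (1 - Φ * towerV D τ (μ k)))
    (hx₁ : 4 * σ * lam * Q' < 1) (hx₂ : 2 * lam * τ * Q' ≤ 1) (hx₃ : exp 1 * τ * lam * Q' < 1)
    (hy : Φ * (τ * (ι₁ * lam + ι₂ / (2 * Q') + ι₃ / (4 * Q' ^ 2) + A' * Q' / 4)) < 1)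
    (hθ : Φ * (exp 1 * τ * (ι₁ * lam) + (exp 1 * τ) ^ 2 * (ι₂ * lam) + (exp 1 * τ) ^ 3 * (ι₃ * lam ^ 2) +
      A' * (exp 1 * τ * Q') * ((exp 1 * τ * lam * Q') ^ 3 / (1 - exp 1 * τ * lam * Q'))) < 1)
    (hu₁ : 4 * Q' ≤ Q) (hu₂ : 2 * τ * ψ * Q' ≤ Q)
    (hclose : A' * (4 * Q') ^ 3 * (4 * σ * lam * Q' / (1 - 4 * σ * lam * Q')) +
      exp 1 * ψ * (2 * τ * ψ * Q') ^ 2 * (τ * (ι₁ * lam + ι₂ / (2 * Q') + ι₃ / (4 * Q' ^ 2) + A' * Q' / 4)) *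
        (Φ * (τ * (ι₁ * lam + ι₂ / (2 * Q') + ι₃ / (4 * Q' ^ 2) + A' * Q' / 4)) /
          (1 - Φ * (τ * (ι₁ * lam + ι₂ / (2 * Q') + ι₃ / (4 * Q' ^ 2) + A' * Q' / 4)))) ≤ A * Q ^ 3) :
    ∀ k, 2 ≤ k → k ≤ K → ∀ t, ∀ p, 3 ≤ p → p ≤ D → b t k p ≤ A * lam ^ (p - 1) * Q ^ p := by
  -- the law for the shifted arrays `j ↦ block j + 1`, with a zero virtual born array at `j = 0`
  have key : ∀ j ≤ K - 1, ∀ t, ∀ p, 3 ≤ p → p ≤ D →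
      (fun (t : T) (j p : ℕ) => if j = 0 then (0 : ℝ) else b t (j + 1) p) t j p ≤ A * lam ^ (p - 1) * Q ^ p := by
    refine towerBorn_le_law_tracks_of_profile (b := fun (t : T) (j p : ℕ) => if j = 0 then (0 : ℝ) else b t (j + 1) p)
      (μ := fun j m => μ (j + 1) m) hlam hQ hσ hΦ hψ hτ hQ'0 hA'0 (fun j m => hμ0 (j + 1) (Nat.succ_pos j) m)
      ?_ ?_ ?_ ?_ ?_ ?_ hx₁ hx₂ hx₃ hy hθ hu₁ hu₂ hclose
    · -- `h0`: the virtual born array at `j = 0`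
      intro t p _ _
      simp only [if_true]
      positivity
    · -- `hprof` at `j` from the re-based profile at block `j + 1`
      intro j hj ih m hm hmD
      refine hprof (j + 1) (Nat.succ_pos j) (by omega) (fun k' hk'2 hk'le t p hp hpD => ?_) m hm hmD
      have h := ih (k' - 1) (by omega) t p hp hpD
      have hk' : k' - 1 ≠ 0 := by omega
      simp only [hk', if_false] at h
      rwa [show k' - 1 + 1 = k' by omega] at h
    · -- `hprof3` likewise
      intro j hj hD3 ih
      refine hprof3 (j + 1) (Nat.succ_pos j) (by omega) hD3 (fun k' hk'2 hk'le t p hp hpD => ?_)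
      have h := ih (k' - 1) (by omega) t p hp hpD
      have hk' : k' - 1 ≠ 0 := by omega
      simp only [hk', if_false] at h
      rwa [show k' - 1 + 1 = k' by omega] at h
    · intro j hj
      exact hι₁ (j + 1) (Nat.succ_pos j) (by omega)
    · intro j hj
      exact hι₂ (j + 1) (Nat.succ_pos j) (by omega)
    · -- `hstep` at `j` is the step over block `j + 1`
      intro t j hj N hN p hp hpD hguard
      simp only [Nat.succ_ne_zero, if_false]
      exact hstep t (j + 1) (Nat.succ_pos j) (by omega) N hN p hp hpD hguard
  intro k hk2 hkK t p hp hpD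
  have h := key (k - 1) (by omega) t p hp hpD
  have hk1 : k - 1 ≠ 0 := by omega
  simp only [hk1, if_false] at h
  rwa [show k - 1 + 1 = k by omega] at h

/-! ## §2 The re-based law on the half-keyed arrays -/

/-- **THE RE-BASED LEVELLED TOWER LAW FROM NAMED INPUTS** (half-keyed arrays of …TowerLevUnitsDefs, measured array scaled `μ k m := W·Z^m·klTowerMuLev … d k m`):
given the BASE profile at block `1` (`hbase`, `hbase3` — «(ℓ)-BASE-LEV» + the grid step at `(Λ_d, F_{d−1})`), the re-based re-measurement BRIDGE at the blocks
`k ≥ 2` (`hR` — the profile of `𝒱_{dk} = 𝒱_d + Σ_{1≤j<k} Δ_j` from the law on the born arrays of blocks `2 … k`), the imports at blocks `k ≥ 1` (E1 (I4)), the step at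
blocks `k ≥ 1` (`klTowerBLev_succ_le_kitStep[_of_bounds]`, verbatim) and the kit's numerics (E1 (I5)), every born array of the blocks `2 ≤ k ≤ K_b` obeys the law
`klTowerBLev … d t k p ≤ Aλ^{p−1}Q^p` (`3 ≤ p ≤ D`, every track).  No model hypothesis is needed or assumed. [cite: BenfattoGiulianiMastropietro2006, §2.8 (2.83), (2.93)-(2.98)] -/
theorem klTowerBLev_le_law_of_inputs_base {L M : ℕ} [NeZero L] [NeZero M] {β : ℝ} (hβ : 0 < β) (U μ : ℝ) (K : TrigPolyC4v)
    (d Kb D : ℕ) {A lam Q W Z A' Q' σ Φ ψ τ ι₁ ι₂ ι₃ : ℝ}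
    (hA : 0 ≤ A) (hlam : 0 < lam) (hQ : 0 ≤ Q) (hW : 0 ≤ W) (hZ : 0 ≤ Z) (hA'0 : 0 ≤ A') (hQ'0 : 0 < Q')
    (hσ : 0 ≤ σ) (hΦ : 0 ≤ Φ) (hψ : 0 ≤ ψ) (hτ : 0 < τ)
    -- the base profile at block 1 (k3c2-p3 «(ℓ)-BASE-LEV» `klTowerMuLev_le_profile_of_wtPinned` + p3's grid step at `(Λ_d, F_{d−1})`)
    (hbase : ∀ m, 4 ≤ m → m ≤ D → W * Z ^ m * klTowerMuLev L M β U μ K d 1 m ≤ A' * lam ^ (m - 1) * Q' ^ m)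
    (hbase3 : 3 ≤ D → W * Z ^ 3 * klTowerMuLev L M β U μ K d 1 3 ≤ ι₃ * lam ^ 2)
    -- the re-based re-measurement bridge at blocks k ≥ 2 (the base datum jumped to `F_{dk−1}` + the born arrays of blocks 2 … k)
    (hR : ∀ k, 2 ≤ k → k < Kb →
      (∀ k', 2 ≤ k' → k' ≤ k → ∀ t : Fin 5, ∀ p, 3 ≤ p → p ≤ D → klTowerBLev L M β U μ K d t k' p ≤ A * lam ^ (p - 1) * Q ^ p) →
      (∀ m, 4 ≤ m → m ≤ D → W * Z ^ m * klTowerMuLev L M β U μ K d k m ≤ A' * lam ^ (m - 1) * Q' ^ m) ∧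
        (3 ≤ D → W * Z ^ 3 * klTowerMuLev L M β U μ K d k 3 ≤ ι₃ * lam ^ 2))
    -- the imports at blocks k ≥ 1 (E1 (I4))
    (hι₁ : ∀ k, 1 ≤ k → k < Kb → W * Z ^ 1 * klTowerMuLev L M β U μ K d k 1 ≤ ι₁ * lam)
    (hι₂ : ∀ k, 1 ≤ k → k < Kb → W * Z ^ 2 * klTowerMuLev L M β U μ K d k 2 ≤ ι₂ * lam)
    -- the step at blocks k ≥ 1 (`klTowerBLev_succ_le_kitStep` p664283 / `…_of_bounds` p666413 §1, verbatim)
    (hstep : ∀ t : Fin 5, ∀ k, 1 ≤ k → k < Kb → ∀ N : ℕ, 2 ≤ N → ∀ p, 3 ≤ p → p ≤ D →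
      Φ * towerV D τ (fun m => W * Z ^ m * klTowerMuLev L M β U μ K d k m) < 1 →
      klTowerBLev L M β U μ K d t (k + 1) p ≤
        towerFO D σ (fun m => W * Z ^ m * klTowerMuLev L M β U μ K d k m) p +
          ∑ n ∈ Icc 2 N, exp 1 * Φ ^ (n - 1) * ψ ^ p * towerS D τ (fun m => W * Z ^ m * klTowerMuLev L M β U μ K d k m) n p +
          ψ ^ p * exp 1 * towerV D τ (fun m => W * Z ^ m * klTowerMuLev L M β U μ K d k m) *
            (Φ * towerV D τ (fun m => W * Z ^ m * klTowerMuLev L M β U μ K d k m)) ^ N /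
            (1 - Φ * towerV D τ (fun m => W * Z ^ m * klTowerMuLev L M β U μ K d k m)))
    -- the kit's numerics (E1 (I5))
    (hx₁ : 4 * σ * lam * Q' < 1) (hx₂ : 2 * lam * τ * Q' ≤ 1) (hx₃ : exp 1 * τ * lam * Q' < 1)
    (hy : Φ * (τ * (ι₁ * lam + ι₂ / (2 * Q') + ι₃ / (4 * Q' ^ 2) + A' * Q' / 4)) < 1)
    (hθ : Φ * (exp 1 * τ * (ι₁ * lam) + (exp 1 * τ) ^ 2 * (ι₂ * lam) + (exp 1 * τ) ^ 3 * (ι₃ * lam ^ 2) +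
      A' * (exp 1 * τ * Q') * ((exp 1 * τ * lam * Q') ^ 3 / (1 - exp 1 * τ * lam * Q'))) < 1)
    (hu₁ : 4 * Q' ≤ Q) (hu₂ : 2 * τ * ψ * Q' ≤ Q)
    (hclose : A' * (4 * Q') ^ 3 * (4 * σ * lam * Q' / (1 - 4 * σ * lam * Q')) +
      exp 1 * ψ * (2 * τ * ψ * Q') ^ 2 * (τ * (ι₁ * lam + ι₂ / (2 * Q') + ι₃ / (4 * Q' ^ 2) + A' * Q' / 4)) *
        (Φ * (τ * (ι₁ * lam + ι₂ / (2 * Q') + ι₃ / (4 * Q' ^ 2) + A' * Q' / 4)) /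
          (1 - Φ * (τ * (ι₁ * lam + ι₂ / (2 * Q') + ι₃ / (4 * Q' ^ 2) + A' * Q' / 4)))) ≤ A * Q ^ 3) :
    ∀ k, 2 ≤ k → k ≤ Kb → ∀ (t : Fin 5) (p : ℕ), 3 ≤ p → p ≤ D →
      klTowerBLev L M β U μ K d t k p ≤ A * lam ^ (p - 1) * Q ^ p := by
  have hWZ : ∀ m : ℕ, 0 ≤ W * Z ^ m := fun m => by positivity
  refine towerBorn_le_law_tracks_of_profile_base (T := Fin 5) (K := Kb) (D := D)
    (b := fun t k p => klTowerBLev L M β U μ K d t k p) (μ := fun k m => W * Z ^ m * klTowerMuLev L M β U μ K d k m)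
    (A := A) (lam := lam) (Q := Q) (A' := A') (Q' := Q') (ι₃ := ι₃) hlam hA hQ hσ hΦ hψ hτ hQ'0 hA'0
    (fun k _ m => mul_nonneg (hWZ m) (klTowerMuLev_nonneg hβ U μ K d k m)) ?_ ?_ hι₁ hι₂ hstep hx₁ hx₂ hx₃ hy hθ hu₁ hu₂ hclose
  · -- the profile: block 1 from the base, blocks k ≥ 2 from the bridge
    intro k hk1 hkK ih m hm hmD
    rcases Nat.lt_or_ge k 2 with hk | hk
    · obtain rfl : k = 1 := by omega
      exact hbase m hm hmD
    · exact (hR k hk hkK ih).1 m hm hmD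
  · intro k hk1 hkK hD3 ih
    rcases Nat.lt_or_ge k 2 with hk | hk
    · obtain rfl : k = 1 := by omega
      exact hbase3 hD3
    · exact (hR k hk hkK ih).2 hD3

/-! ## §3 The re-based law on the floor-keyed arrays -/

/-- **THE RE-BASED LEVELLED TOWER LAW FROM NAMED INPUTS, FLOOR-KEYED** (arrays `klTowerBLevF/klTowerMuLevF` of …TowerLevFloorUnitsDefs, cure (ε) of «(ℓ)-LEV-ODD»;
measured array scaled `μ k m := W·Z^m·klTowerMuLevF … d k m`): the same assembly as `klTowerBLev_le_law_of_inputs_base`.  The base/bridge/import inputs transfer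
from every half-keyed upper bound by `klTowerMuLevF_le_klTowerMuLev`; the step input is the floor-keyed LINK (to come with «(I1)-LEV-FLOOR»).
[cite: BenfattoGiulianiMastropietro2006, §2.8 (2.83), (2.93)-(2.98)] -/
theorem klTowerBLevF_le_law_of_inputs_base {L M : ℕ} [NeZero L] [NeZero M] {β : ℝ} (hβ : 0 < β) (U μ : ℝ) (K : TrigPolyC4v)
    (d Kb D : ℕ) {A lam Q W Z A' Q' σ Φ ψ τ ι₁ ι₂ ι₃ : ℝ}
    (hA : 0 ≤ A) (hlam : 0 < lam) (hQ : 0 ≤ Q) (hW : 0 ≤ W) (hZ : 0 ≤ Z) (hA'0 : 0 ≤ A') (hQ'0 : 0 < Q')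
    (hσ : 0 ≤ σ) (hΦ : 0 ≤ Φ) (hψ : 0 ≤ ψ) (hτ : 0 < τ)
    -- the base profile at block 1
    (hbase : ∀ m, 4 ≤ m → m ≤ D → W * Z ^ m * klTowerMuLevF L M β U μ K d 1 m ≤ A' * lam ^ (m - 1) * Q' ^ m)
    (hbase3 : 3 ≤ D → W * Z ^ 3 * klTowerMuLevF L M β U μ K d 1 3 ≤ ι₃ * lam ^ 2)
    -- the re-based re-measurement bridge at blocks k ≥ 2
    (hR : ∀ k, 2 ≤ k → k < Kb →
      (∀ k', 2 ≤ k' → k' ≤ k → ∀ t : Fin 5, ∀ p, 3 ≤ p → p ≤ D → klTowerBLevF L M β U μ K d t k' p ≤ A * lam ^ (p - 1) * Q ^ p) →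
      (∀ m, 4 ≤ m → m ≤ D → W * Z ^ m * klTowerMuLevF L M β U μ K d k m ≤ A' * lam ^ (m - 1) * Q' ^ m) ∧
        (3 ≤ D → W * Z ^ 3 * klTowerMuLevF L M β U μ K d k 3 ≤ ι₃ * lam ^ 2))
    -- the imports at blocks k ≥ 1
    (hι₁ : ∀ k, 1 ≤ k → k < Kb → W * Z ^ 1 * klTowerMuLevF L M β U μ K d k 1 ≤ ι₁ * lam)
    (hι₂ : ∀ k, 1 ≤ k → k < Kb → W * Z ^ 2 * klTowerMuLevF L M β U μ K d k 2 ≤ ι₂ * lam)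
    -- the floor-keyed step at blocks k ≥ 1 («(I1)-LEV-FLOOR» LINK)
    (hstep : ∀ t : Fin 5, ∀ k, 1 ≤ k → k < Kb → ∀ N : ℕ, 2 ≤ N → ∀ p, 3 ≤ p → p ≤ D →
      Φ * towerV D τ (fun m => W * Z ^ m * klTowerMuLevF L M β U μ K d k m) < 1 →
      klTowerBLevF L M β U μ K d t (k + 1) p ≤
        towerFO D σ (fun m => W * Z ^ m * klTowerMuLevF L M β U μ K d k m) p +
          ∑ n ∈ Icc 2 N, exp 1 * Φ ^ (n - 1) * ψ ^ p * towerS D τ (fun m => W * Z ^ m * klTowerMuLevF L M β U μ K d k m) n p +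
          ψ ^ p * exp 1 * towerV D τ (fun m => W * Z ^ m * klTowerMuLevF L M β U μ K d k m) *
            (Φ * towerV D τ (fun m => W * Z ^ m * klTowerMuLevF L M β U μ K d k m)) ^ N /
            (1 - Φ * towerV D τ (fun m => W * Z ^ m * klTowerMuLevF L M β U μ K d k m)))
    -- the kit's numerics
    (hx₁ : 4 * σ * lam * Q' < 1) (hx₂ : 2 * lam * τ * Q' ≤ 1) (hx₃ : exp 1 * τ * lam * Q' < 1)
    (hy : Φ * (τ * (ι₁ * lam + ι₂ / (2 * Q') + ι₃ / (4 * Q' ^ 2) + A' * Q' / 4)) < 1)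
    (hθ : Φ * (exp 1 * τ * (ι₁ * lam) + (exp 1 * τ) ^ 2 * (ι₂ * lam) + (exp 1 * τ) ^ 3 * (ι₃ * lam ^ 2) +
      A' * (exp 1 * τ * Q') * ((exp 1 * τ * lam * Q') ^ 3 / (1 - exp 1 * τ * lam * Q'))) < 1)
    (hu₁ : 4 * Q' ≤ Q) (hu₂ : 2 * τ * ψ * Q' ≤ Q)
    (hclose : A' * (4 * Q') ^ 3 * (4 * σ * lam * Q' / (1 - 4 * σ * lam * Q')) +
      exp 1 * ψ * (2 * τ * ψ * Q') ^ 2 * (τ * (ι₁ * lam + ι₂ / (2 * Q') + ι₃ / (4 * Q' ^ 2) + A' * Q' / 4)) *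
        (Φ * (τ * (ι₁ * lam + ι₂ / (2 * Q') + ι₃ / (4 * Q' ^ 2) + A' * Q' / 4)) /
          (1 - Φ * (τ * (ι₁ * lam + ι₂ / (2 * Q') + ι₃ / (4 * Q' ^ 2) + A' * Q' / 4)))) ≤ A * Q ^ 3) :
    ∀ k, 2 ≤ k → k ≤ Kb → ∀ (t : Fin 5) (p : ℕ), 3 ≤ p → p ≤ D →
      klTowerBLevF L M β U μ K d t k p ≤ A * lam ^ (p - 1) * Q ^ p := by
  have hWZ : ∀ m : ℕ, 0 ≤ W * Z ^ m := fun m => by positivity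
  refine towerBorn_le_law_tracks_of_profile_base (T := Fin 5) (K := Kb) (D := D)
    (b := fun t k p => klTowerBLevF L M β U μ K d t k p) (μ := fun k m => W * Z ^ m * klTowerMuLevF L M β U μ K d k m)
    (A := A) (lam := lam) (Q := Q) (A' := A') (Q' := Q') (ι₃ := ι₃) hlam hA hQ hσ hΦ hψ hτ hQ'0 hA'0
    (fun k _ m => mul_nonneg (hWZ m) (klTowerMuLevF_nonneg hβ U μ K d k m)) ?_ ?_ hι₁ hι₂ hstep hx₁ hx₂ hx₃ hy hθ hu₁ hu₂ hclose
  · intro k hk1 hkK ih m hm hmD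
    rcases Nat.lt_or_ge k 2 with hk | hk
    · obtain rfl : k = 1 := by omega
      exact hbase m hm hmD
    · exact (hR k hk hkK ih).1 m hm hmD
  · intro k hk1 hkK hD3 ih
    rcases Nat.lt_or_ge k 2 with hk | hk
    · obtain rfl : k = 1 := by omega
      exact hbase3 hD3
    · exact (hR k hk hkK ih).2 hD3

end Summit.HubbardSuperconductivity.HubbardSuperconductivity.Theorems.EngineV8

end
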